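import Summits.AnomalousDissipation.AnomalousDissipation.Theorems.BaireTransferRobustLoudUpgradeLine

/-!
# Stub `stub_crossingPersist` of the line `malkin-cone-group-orbits` (crux stmt-AnomalousDissipation-1144,
# companion lead c2, "Lyapunov–Schmidt crossing"): the CROSSING ENGINE (E1) (pure topology)

Registered stub (Pi-form):
`∀ (S : Finset (Fin 3 → ℤ)) (c : Coeff S) (ν : ℝ) (u₀ : UnitAddTorus (Fin 3) → EuclideanSpace ℝ (Fin 3))
 (σ : Coeff S × ℝ → ℝ), (∀ δ : ℝ, 0 < δ → ∃ r : ℝ, 0 < r ∧ ContinuousOn σ (Metric.ball (c, (0 : ℝ)) r) ∧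
 ∀ q ∈ Metric.ball (c, (0 : ℝ)) r, σ q = 0 → ∃ u' p', Torus.IsSteadyNSState ν (force S q.1) u' p' ∧ HasZeroMean u' ∧
 h1DistSq u' u₀ < δ) → (∀ η : ℝ, 0 < η → ∃ x₁ x₂ : ℝ, |x₁| < η ∧ |x₂| < η ∧ σ (c, x₁) < 0 ∧ 0 < σ (c, x₂)) →
 SteadyPersistsAt S c ν u₀`.

Content.  The zeros of a real Lyapunov–Schmidt function `σ(c', x)`, continuous near `(c, 0)`, produce mean-zero
classical steady states of the (uncorrected) force `f_{c'}` that are `H¹`-close to `u₀`; if `σ(c, ·)` takes BOTH signs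
arbitrarily close to `0`, then `u₀` persists (`SteadyPersistsAt S c ν u₀`).  Nothing analytic is used: the conjunction
`Torus.IsSteadyNSState … ∧ HasZeroMean … ∧ h1DistSq … < δ` is an opaque predicate handed over by the first hypothesis.

Proof idea (folklore topology; the index-`±1` persistence principle behind Chow–Hale, *Methods of Bifurcation
Theory* (1982), Ch. 2 and Ch. 6).  Fix `δ > 0`; the first hypothesis gives `r > 0` with `σ` continuous on the open
ball `B := ball (c, 0) r` (sup metric on the product, `Prod.dist_eq`) whose zeros are good.  The second hypothesis
with `η := r / 2` gives `x₁, x₂` with `|xᵢ| < r / 2`, `σ(c, x₁) < 0 < σ(c, x₂)`.  Continuity of `σ` at the interior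
points `(c, xᵢ)` gives `ρᵢ > 0` such that the two strict signs survive at `(c', xᵢ)` whenever `dist c' c < ρᵢ`.  With
`ρ := min (min ρ₁ ρ₂) (r / 2)` and `dist c' c < ρ`, the whole segment `{c'} × uIcc x₁ x₂` lies in `B`, so
`x ↦ σ(c', x)` is continuous on `uIcc x₁ x₂` and the intermediate value theorem (`intermediate_value_uIcc`) yields a
zero `(c', x) ∈ B`, hence a good steady state of `f_{c'}`.
-/

-- `Summit.<Summit>.<Problem>` is the tree's mandated summit-side namespace (CONVENTIONS §2); for this
-- single-conjunct summit the two coincide, so the duplicate is deliberate.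
set_option linter.dupNamespace false

noncomputable section

open scoped BigOperators Topology
open Filter Set Function TopologicalSpace MeasureTheory

namespace Summit.AnomalousDissipation.AnomalousDissipation.Theorems.RobustLoudUpgrade.CrossingPersist

open Summit.AnomalousDissipation.AnomalousDissipation.Theorems.RobustLoudUpgrade
open Literature.Analysis.FunctionSpaces Literature.Analysis.FunctionSpaces.Torus
open Literature.Analysis.FluidPDE

/-- Sup metric on a product: moving only the first coordinate. [folklore] -/
private lemma dist_mk_same_snd {V : Type*} [PseudoMetricSpace V] (c' c : V) (x : ℝ) :
    dist (c', x) (c, x) = dist c' c := by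
  rw [Prod.dist_eq]
  show max (dist c' c) (dist x x) = dist c' c
  rw [dist_self, max_eq_left dist_nonneg]

/-- Sup metric on a product: `(c', x)` is `ρ`-close to `(c, 0)` as soon as `dist c' c < ρ` and `|x| < ρ`.
[folklore] -/
private lemma dist_mk_lt {V : Type*} [PseudoMetricSpace V] {c' c : V} {x ρ : ℝ}
    (hc : dist c' c < ρ) (hx : |x| < ρ) : dist (c', x) (c, (0 : ℝ)) < ρ := by
  rw [Prod.dist_eq]
  show max (dist c' c) (dist x 0) < ρ
  rw [Real.dist_eq, sub_zero]
  exact max_lt hc hx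

/-- A point of `uIcc x₁ x₂` is bounded in absolute value by the larger endpoint: `|xᵢ| < η ⇒ |x| < η`.
[folklore] -/
private lemma abs_lt_of_mem_uIcc {x x₁ x₂ η : ℝ} (hx : x ∈ Set.uIcc x₁ x₂) (h₁ : |x₁| < η) (h₂ : |x₂| < η) :
    |x| < η := by
  rw [abs_lt] at h₁ h₂ ⊢
  rcases Set.mem_uIcc.1 hx with ⟨h1, h2⟩ | ⟨h1, h2⟩
  · exact ⟨by linarith, by linarith⟩
  · exact ⟨by linarith, by linarith⟩

/-- **Stub `stub_crossingPersist` (the crossing engine (E1)).**  If the zeros of a real function `σ`, continuous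
near `(c, 0)`, produce mean-zero steady states of the uncorrected forces `H¹`-close to `u₀` (for every `δ` on a
suitable ball), and `σ(c, ·)` takes both signs arbitrarily close to `0`, then `u₀` PERSISTS: by continuity the two
strict signs survive at every `c'` near `c`, and the intermediate value theorem gives a zero `(c', x)` inside the
ball. [folklore] -/
theorem stub_crossingPersist :
    ∀ (S : Finset (Fin 3 → ℤ)) (c : Coeff S) (ν : ℝ) (u₀ : UnitAddTorus (Fin 3) → EuclideanSpace ℝ (Fin 3))
      (σ : Coeff S × ℝ → ℝ),
      (∀ δ : ℝ, 0 < δ → ∃ r : ℝ, 0 < r ∧ ContinuousOn σ (Metric.ball (c, (0 : ℝ)) r) ∧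
        ∀ q ∈ Metric.ball (c, (0 : ℝ)) r, σ q = 0 →
          ∃ (u' : UnitAddTorus (Fin 3) → EuclideanSpace ℝ (Fin 3)) (p' : UnitAddTorus (Fin 3) → ℝ),
            Torus.IsSteadyNSState ν (force S q.1) u' p' ∧ HasZeroMean u' ∧ h1DistSq u' u₀ < δ) →
      (∀ η : ℝ, 0 < η → ∃ x₁ x₂ : ℝ, |x₁| < η ∧ |x₂| < η ∧ σ (c, x₁) < 0 ∧ 0 < σ (c, x₂)) →
      SteadyPersistsAt S c ν u₀ := by
  intro S c ν u₀ σ hfam hsign δ hδ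
  obtain ⟨r, hr, hcont, hzero⟩ := hfam δ hδ
  -- `σ` is continuous at every point of the open ball (ε/ρ form)
  have hat : ∀ q ∈ Metric.ball (c, (0 : ℝ)) r, ∀ ε : ℝ, 0 < ε →
      ∃ ρ : ℝ, 0 < ρ ∧ ∀ q' : Coeff S × ℝ, dist q' q < ρ → dist (σ q') (σ q) < ε := by
    intro q hq ε hε
    have hca : ContinuousAt σ q := hcont.continuousAt (Metric.isOpen_ball.mem_nhds hq)
    obtain ⟨ρ, hρ, h⟩ := Metric.continuousAt_iff.1 hca ε hε
    exact ⟨ρ, hρ, fun q' hq' => h hq'⟩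
  -- (i) two strict signs of `σ (c, ·)` at heights `|xᵢ| < r / 2`
  obtain ⟨x₁, x₂, hx₁, hx₂, hσ₁, hσ₂⟩ := hsign (r / 2) (by positivity)
  have hcc : dist c c < r / 2 := by
    rw [dist_self]
    positivity
  have hcx₁ : (c, x₁) ∈ Metric.ball (c, (0 : ℝ)) r := by
    rw [Metric.mem_ball]
    exact (dist_mk_lt hcc hx₁).trans_le (by linarith)
  have hcx₂ : (c, x₂) ∈ Metric.ball (c, (0 : ℝ)) r := by
    rw [Metric.mem_ball]
    exact (dist_mk_lt hcc hx₂).trans_le (by linarith)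
  -- (ii) radii `ρ₁, ρ₂` on which the two signs survive, and the persistence radius `ρ`
  obtain ⟨ρ₁, hρ₁, hρ₁σ⟩ := hat _ hcx₁ (-σ (c, x₁)) (neg_pos.2 hσ₁)
  obtain ⟨ρ₂, hρ₂, hρ₂σ⟩ := hat _ hcx₂ (σ (c, x₂)) hσ₂
  obtain ⟨ρ, hρ, hρ₁', hρ₂', hρr⟩ : ∃ ρ : ℝ, 0 < ρ ∧ ρ ≤ ρ₁ ∧ ρ ≤ ρ₂ ∧ ρ ≤ r / 2 :=
    ⟨min (min ρ₁ ρ₂) (r / 2), lt_min (lt_min hρ₁ hρ₂) (by positivity),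
      (min_le_left _ _).trans (min_le_left _ _), (min_le_left _ _).trans (min_le_right _ _),
      min_le_right _ _⟩
  refine ⟨ρ, hρ, fun c' hc' => ?_⟩
  -- (iii) the segment `{c'} × uIcc x₁ x₂` lies in the ball, so `x ↦ σ (c', x)` is continuous on it
  have hseg : Set.MapsTo (fun x : ℝ => ((c', x) : Coeff S × ℝ)) (Set.uIcc x₁ x₂)
      (Metric.ball (c, (0 : ℝ)) r) := by
    intro x hx
    rw [Metric.mem_ball]
    exact (dist_mk_lt (hc'.trans_le hρr) (abs_lt_of_mem_uIcc hx hx₁ hx₂)).trans_le (by linarith)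
  have hf : Continuous fun x : ℝ => ((c', x) : Coeff S × ℝ) := by fun_prop
  have hcont' : ContinuousOn (fun x : ℝ => σ (c', x)) (Set.uIcc x₁ x₂) :=
    hcont.comp hf.continuousOn hseg
  -- (iv) the two strict signs survive at `c'`
  have h1 : σ (c', x₁) < 0 := by
    have h := hρ₁σ (c', x₁) (by rw [dist_mk_same_snd]; exact hc'.trans_le hρ₁')
    rw [Real.dist_eq, abs_lt] at h
    linarith [h.2]
  have h2 : 0 < σ (c', x₂) := by
    have h := hρ₂σ (c', x₂) (by rw [dist_mk_same_snd]; exact hc'.trans_le hρ₂')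
    rw [Real.dist_eq, abs_lt] at h
    linarith [h.1]
  -- (v) intermediate value theorem: a zero `(c', x)` in the ball, hence a good steady state of `f_{c'}`
  have hmem : (0 : ℝ) ∈ Set.uIcc (σ (c', x₁)) (σ (c', x₂)) := Set.mem_uIcc.2 (Or.inl ⟨h1.le, h2.le⟩)
  obtain ⟨x, hx, hσx⟩ := intermediate_value_uIcc hcont' hmem
  obtain ⟨u', p', hst, h0, hd⟩ := hzero _ (hseg hx) hσx
  exact ⟨u', p', hst, h0, hd⟩

end Summit.AnomalousDissipation.AnomalousDissipation.Theorems.RobustLoudUpgrade.CrossingPersist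

end
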